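import Summits.BirchSwinnertonDyer.Rank1Residual.Additive.KobayashiLayerSaturation
import Literature.NumberTheory.EllipticCurves.IwasawaSelmerSupersingularLocalProofs
import Literature.NumberTheory.GaloisRepresentations.ClosureValuation
import Literature.NumberTheory.GaloisRepresentations.UnramifiedAdmissible
import HarnessLib

/-!
# Odd saturation of `E₁(ℚ̄₂)` at a good supersingular `2`: every point of `E(ℚ̄₂)` has an ODD multiple in the kernel of
# reduction, and the `2`-power torsion lies in it — for the crux `SignedTransportAtTwo` (stmt-BirchSwinnertonDyer-20333,
# route `ThetaPartnerAtTwo`, line `bridge` v16, stub `stub_sel2Tb`, step T3) (lead prover bsd-wall-tp2-p1 g5;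
# `--supports stmt-BirchSwinnertonDyer-20333`; route-independent, closes nothing)

HONEST FRAMING. THEOREMS ONLY (no definition); nothing about any Selmer group is asserted; BSD is not proved by any of this.
No import of any route file.

WHAT (`Ω = ℚ̄₂`, `𝒪` its valuation ring with residue field `k ⊇ 𝔽₂`, `M / ℤ₂` with `M mod 2` elliptic and `a₂(M) = 0`,
i.e. `#M̃(𝔽₂) = 3`). The reduction homomorphism `E(Ω) → M̃(k)` of the tree (`goodReductionHom` of the model `M ⊗ 𝒪`,
Silverman VII.2.1) has kernel `E₁(Ω)`; `#M̃(𝔽₂)` odd forces `a₁ = 0`, hence `M̃` has no point of order `2` over any field of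
characteristic `2` (`eq_zero_of_two_nsmul_eq_zero_of_a₁_eq_zero`); and `k` is algebraic over `𝔽₂` (§1: `𝒪` is integral over
`ℤ₂`, `mem_absIntegers_iff_spectralNorm_le_one`), so every point of `M̃(k)` lies in the finite group `M̃(𝔽₂(x, y))`, of order
`2^a·m` with `m` odd. Hence:
* `mem_kernel_of_two_pow_nsmul_eq_zero` — **`E(Ω)[2^∞] ⊆ E₁(Ω)`**;
* `exists_odd_nsmul_mem_kernel` — **every `P ∈ E(Ω)` has an odd `m` with `m • P ∈ E₁(Ω)`** (the hypothesis `hsat` of the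
  retraction `…FormalRetraction.exists_retraction` at `p = 2`).

References: [SilvermanAEC2009] VII.2.1, V.3.1(a), App. A Prop. 1.1; [Kobayashi2003] §8.4; [NeukirchANT1999] II (4.8).
-/

set_option autoImplicit false
-- D-0017: single-problem summit, so `Summit.BirchSwinnertonDyer.BirchSwinnertonDyer.…` repeats a namespace BY DESIGN.
set_option linter.dupNamespace false

noncomputable section

open scoped Classical NNReal

open Polynomial WeierstrassCurve Literature.NumberTheory.EllipticCurves Literature.NumberTheory.GaloisRepresentations
  Literature.NumberTheory.EllipticCurves.FormalGroupChart
  Summit.BirchSwinnertonDyer.Rank1Residual.Additive Summit.BirchSwinnertonDyer.Rank1Residual.Additive.BallEval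

namespace Summit.BirchSwinnertonDyer.BirchSwinnertonDyer.Theorems.SignedTransportAtTwo

variable {p : ℕ} [hp : Fact p.Prime]

/-! ## §1 The residue field of `𝒪_Ω` is algebraic over `𝔽_p` -/

/-- **Every element of `k = 𝒪_Ω/𝔪` is integral over `𝔽_p`** (along `zmodToResidueΩ`): an element of `𝒪_Ω` is integral over
`ℤ_p` (`‖x‖ ≤ 1 ⇔ x` integral, tree `mem_absIntegers_iff_spectralNorm_le_one`); reduce a monic equation.
[cite: NeukirchANT1999, Ch. II (4.8)] -/
theorem isIntegral_residue_intΩ (z : IsLocalRing.ResidueField (intΩ p)) :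
    letI := (zmodToResidueΩ p).toAlgebra
    _root_.IsIntegral (ZMod p) z := by
  letI := (zmodToResidueΩ p).toAlgebra
  obtain ⟨a, rfl⟩ := Ideal.Quotient.mk_surjective z
  -- `a` is integral over `ℤ_p ≅ padicValuationSubring p`
  have ha1 : ‖(a : PadicAlgCl p)‖ ≤ 1 := (mem_intΩ_iff _).mp a.2
  have hint : (a : PadicAlgCl p) ∈ absIntegers (padicValuationSubring p) ℚ_[p] := by
    rw [mem_absIntegers_iff_spectralNorm_le_one (padicValuationSubring p) (fun x ↦ mem_padicValuationSubring_iff),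
      PadicAlgCl.spectralNorm_eq]
    exact ha1
  obtain ⟨P, hPm, hPa⟩ := (mem_integralClosure_iff (padicValuationSubring p) _).mp hint
  -- the structure maps
  set ι : padicValuationSubring p →+* intΩ p := (padicIntToIntΩ p).comp (padicValuationSubringEquiv p).toRingHom
    with hιdef
  have hι : ∀ r : padicValuationSubring p, ((ι r : intΩ p) : PadicAlgCl p) =
      algebraMap (padicValuationSubring p) (PadicAlgCl p) r := fun r ↦ by
    rw [hιdef, RingHom.comp_apply, coe_padicIntToIntΩ]
    rfl
  set φ : padicValuationSubring p →+* ZMod p := (PadicInt.toZMod (p := p)).comp (padicValuationSubringEquiv p).toRingHom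
    with hφdef
  have hφres : ∀ r : padicValuationSubring p,
      IsLocalRing.residue (intΩ p) (ι r) = zmodToResidueΩ p (φ r) := fun r ↦ by
    rw [hιdef, hφdef, RingHom.comp_apply, RingHom.comp_apply, residue_padicIntToIntΩ]
  refine ⟨P.map φ, hPm.map _, ?_⟩
  -- the monic equation holds in `𝒪_Ω` …
  have h1 : P.eval₂ ι a = 0 := by
    apply Subtype.val_injective
    change ((intΩ p).subtype) (P.eval₂ ι a) = 0
    rw [Polynomial.hom_eval₂]
    have hc : (intΩ p).subtype.comp ι = algebraMap (padicValuationSubring p) (PadicAlgCl p) :=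
      RingHom.ext fun r ↦ hι r
    rw [hc]
    exact hPa
  -- … and reduces to the required one
  have h2 := congrArg (IsLocalRing.residue (intΩ p)) h1
  rw [Polynomial.hom_eval₂, map_zero] at h2
  rw [Polynomial.eval₂_map]
  change P.eval₂ ((zmodToResidueΩ p).comp φ) (IsLocalRing.residue (intΩ p) a) = 0
  convert h2 using 2
  exact RingHom.ext fun r ↦ (hφres r).symm

/-! ## §2 Good supersingular reduction at `2`: no `2`-torsion on the reduction, odd saturation -/

section Two

variable (M : WeierstrassCurve ℤ_[2]) [hE : (M.map PadicInt.Coe.ringHom).IsElliptic]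
  [hEt : (M.map PadicInt.toZMod).IsElliptic]
  [hintΩ : ((M.map (PadicInt.Coe.ringHom (p := 2))).baseChange (PadicAlgCl 2)).IsIntegral (Valued.v (R := PadicAlgCl 2)).integer]

omit hE hintΩ in
/-- `a₂(M) = 0` ⇒ `#M̃(𝔽₂) = 3` is odd ⇒ `a₁(M̃) = 0`. [cite: SilvermanAEC2009, App. A Prop. 1.1] -/
theorem a₁_toZMod_eq_zero (htr : Literature.NumberTheory.EllipticCurves.HasseManin.tr (M.map PadicInt.toZMod) = 0) :
    (M.map PadicInt.toZMod).a₁ = 0 := by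
  have h3 : Nat.card (M.map PadicInt.toZMod).toAffine.Point = 3 := natCard_point_eq_of_tr_eq_zero (p := 2) (M := M) htr
  exact (M.map PadicInt.toZMod).a₁_eq_zero_of_odd_natCard_point (by rw [h3]; decide)

omit hE hintΩ in
/-- **The reduction has no point of order `2` over any field of characteristic `2`** (`a₁ = 0`: Silverman A.1.1 / V.3.1;
the tree's `eq_zero_of_two_nsmul_eq_zero_of_a₁_eq_zero`), in the form `2^k • R = O ⇒ R = O`.
[cite: SilvermanAEC2009, V.3.1(a), App. A Prop. 1.1] -/
theorem eq_zero_of_two_pow_nsmul_eq_zero_reduction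
    (htr : Literature.NumberTheory.EllipticCurves.HasseManin.tr (M.map PadicInt.toZMod) = 0)
    {k : Type*} [Field k] [CharP k 2] (f : ZMod 2 →+* k) (R : ((M.map PadicInt.toZMod).map f).toAffine.Point)
    (n : ℕ) (hR : 2 ^ n • R = 0) : R = 0 := by
  have ha₁ : ((M.map PadicInt.toZMod).map f).a₁ = 0 := by
    rw [WeierstrassCurve.map_a₁, a₁_toZMod_eq_zero M htr, map_zero]
  induction n generalizing R with
  | zero => simpa using hR
  | succ n ih =>
    have h2 : 2 • (2 ^ n • R) = 0 := by rw [← mul_nsmul', ← pow_succ', hR]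
    have h1 := ((M.map PadicInt.toZMod).map f).eq_zero_of_two_nsmul_eq_zero_of_a₁_eq_zero ha₁ _ h2
    exact ih R h1

omit hE in
/-- **Reduction criterion for `E₁(Ω)`**: a point of `E(Ω)` whose reduction (via the model `M ⊗ 𝒪_Ω`, Silverman VII.2.1) is `Õ`
lies in the kernel of reduction `E₁(Ω)`. [cite: SilvermanAEC2009, Prop. VII.2.1] -/
theorem mem_kernel_of_goodReductionHom_eq_zero
    (Q : ((M.map (PadicInt.Coe.ringHom (p := 2))).baseChange (PadicAlgCl 2)).toAffine.Point)
    (h0 : goodReductionHom (modelΩ 2 M) (integers_intΩ 2) (isUnit_Δ_modelΩ 2 M)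
      (Affine.Point.congrEquiv (modelΩ_baseChange 2 M).symm Q) = 0) :
    Q ∈ kernel (Valued.v (R := PadicAlgCl 2)) ((M.map (PadicInt.Coe.ringHom (p := 2))).baseChange (PadicAlgCl 2)) := by
  have hv := integers_intΩ 2
  have hker : WeierstrassCurve.ReducesToZero (modelΩ 2 M) (Affine.Point.congrEquiv (modelΩ_baseChange 2 M).symm Q) :=
    (goodReductionHom_eq_zero_iff hv (isUnit_Δ_modelΩ 2 M) _).mp h0
  intro x y hxy hQ
  rw [hQ, Affine.Point.congrEquiv_some, WeierstrassCurve.reducesToZero_some_iff, not_mem_range_iff hv] at hker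
  exact hker

omit hE in
include hEt in
/-- **`E(Ω)[2^∞] ⊆ E₁(Ω)` at a good supersingular `2`**: a point killed by a power of `2` reduces to a `2`-power torsion point of
`M̃(k)`, which is `Õ`. [cite: SilvermanAEC2009, Prop. VII.2.1 and V.3.1(a)] -/
theorem mem_kernel_of_two_pow_nsmul_eq_zero
    (htr : Literature.NumberTheory.EllipticCurves.HasseManin.tr (M.map PadicInt.toZMod) = 0)
    {Q : ((M.map (PadicInt.Coe.ringHom (p := 2))).baseChange (PadicAlgCl 2)).toAffine.Point} {n : ℕ} (hQ : 2 ^ n • Q = 0) :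
    Q ∈ kernel (Valued.v (R := PadicAlgCl 2)) ((M.map (PadicInt.Coe.ringHom (p := 2))).baseChange (PadicAlgCl 2)) := by
  haveI := charP_residueField_intΩ 2
  set R := goodReductionHom (modelΩ 2 M) (integers_intΩ 2) (isUnit_Δ_modelΩ 2 M)
    (Affine.Point.congrEquiv (modelΩ_baseChange 2 M).symm Q) with hR
  have h2R : 2 ^ n • R = 0 := by rw [hR, ← map_nsmul, ← map_nsmul, hQ, map_zero, map_zero]
  have hR' := eq_zero_of_two_pow_nsmul_eq_zero_reduction M htr (zmodToResidueΩ 2)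
    (Affine.Point.congrEquiv (modelΩ_map_residue 2 M) R) n (by rw [← map_nsmul, h2R, map_zero])
  have hR0 : R = 0 := by
    have := congrArg (Affine.Point.congrEquiv (modelΩ_map_residue 2 M)).symm hR'
    rwa [AddEquiv.symm_apply_apply, map_zero] at this
  intro x y h hQ'
  exact mem_kernel_of_goodReductionHom_eq_zero M Q hR0 hQ'

omit hE in
include hEt in
/-- **Odd saturation at a good supersingular `2`: every `Q ∈ E(Ω)` has an ODD `m` with `m • Q ∈ E₁(Ω)`.** The reduction of
`Q` lies in `M̃(k)` with coordinates algebraic over `𝔽₂` (§1), hence in the finite group `M̃(𝔽₂(x̄, ȳ))` of order `2^a·m`;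
`M̃` has no point of order `2`, so `m` already kills it. [cite: SilvermanAEC2009, Prop. VII.2.1 and V.3.1(a)]
[cite: Kobayashi2003, §8.4] -/
theorem exists_odd_nsmul_mem_kernel
    (htr : Literature.NumberTheory.EllipticCurves.HasseManin.tr (M.map PadicInt.toZMod) = 0)
    (Q : ((M.map (PadicInt.Coe.ringHom (p := 2))).baseChange (PadicAlgCl 2)).toAffine.Point) :
    ∃ m : ℕ, ¬ 2 ∣ m ∧
      m • Q ∈ kernel (Valued.v (R := PadicAlgCl 2)) ((M.map (PadicInt.Coe.ringHom (p := 2))).baseChange (PadicAlgCl 2)) := by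
  haveI := charP_residueField_intΩ 2
  letI : Algebra (ZMod 2) (IsLocalRing.ResidueField (intΩ 2)) := (zmodToResidueΩ 2).toAlgebra
  set red := goodReductionHom (modelΩ 2 M) (integers_intΩ 2) (isUnit_Δ_modelΩ 2 M) with hred
  set e := Affine.Point.congrEquiv (modelΩ_baseChange 2 M).symm with he
  -- the reduced curve as a base change of `M mod 2`
  have hEred : (modelΩ 2 M).map (IsLocalRing.residue (intΩ 2)) =
      (M.map PadicInt.toZMod).baseChange (IsLocalRing.ResidueField (intΩ 2)) := modelΩ_map_residue 2 M
  set e' := Affine.Point.congrEquiv hEred with he'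
  set R := e' (red (e Q)) with hR
  -- it suffices to kill `R` by an odd `m`
  suffices h : ∃ m : ℕ, ¬ 2 ∣ m ∧ m • R = 0 by
    obtain ⟨m, hm, hmR⟩ := h
    have h0 : red (e (m • Q)) = 0 := by
      rw [map_nsmul, map_nsmul]
      have := congrArg e'.symm hmR
      rwa [map_nsmul, hR, AddEquiv.symm_apply_apply, map_zero] at this
    exact ⟨m, hm, fun {x} {y} {h} hQ' ↦ mem_kernel_of_goodReductionHom_eq_zero M _ h0 hQ'⟩
  rcases R with _ | ⟨a, b, hab⟩
  · exact ⟨1, by norm_num, by simp [WeierstrassCurve.Affine.Point.zero_def]⟩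
  · -- pass to the finite field `𝔽₂(a, b)`
    have ha : _root_.IsIntegral (ZMod 2) a := isIntegral_residue_intΩ (p := 2) a
    have hb : _root_.IsIntegral (ZMod 2) b := isIntegral_residue_intΩ (p := 2) b
    set K' : IntermediateField (ZMod 2) (IsLocalRing.ResidueField (intΩ 2)) := IntermediateField.adjoin (ZMod 2) {a, b}
      with hK'
    haveI : FiniteDimensional (ZMod 2) K' := IntermediateField.finiteDimensional_adjoin_pair ha hb
    haveI : Finite K' := Module.finite_of_finite (ZMod 2)
    haveI : CharP K' 2 := (algebraMap (ZMod 2) K').charP_iff_charP 2 |>.mp inferInstance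
    have haK : a ∈ K' := IntermediateField.subset_adjoin (ZMod 2) _ (by simp)
    have hbK : b ∈ K' := IntermediateField.subset_adjoin (ZMod 2) _ (by simp)
    have h' : ((M.map PadicInt.toZMod).baseChange K').toAffine.Nonsingular ⟨a, haK⟩ ⟨b, hbK⟩ :=
      (Affine.baseChange_nonsingular (W := (M.map PadicInt.toZMod).toAffine) (f := K'.val) Subtype.val_injective _ _).mp hab
    set R' : ((M.map PadicInt.toZMod).baseChange K').toAffine.Point := Affine.Point.some _ _ h' with hR'
    have hmap : Affine.Point.map K'.val R' = Affine.Point.some a b hab := by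
      rw [hR', Affine.Point.map_some]; rfl
    haveI := ((M.map PadicInt.toZMod).baseChange K').finite_point_of_finite
    -- the order of the finite group `M̃(K')`, split as `2^a · m`
    have hN0 : Nat.card ((M.map PadicInt.toZMod).baseChange K').toAffine.Point ≠ 0 := Nat.card_pos.ne'
    obtain ⟨k, m, hm, hN⟩ := Nat.exists_eq_two_pow_mul_odd hN0
    refine ⟨m, fun h ↦ (Nat.not_even_iff_odd.mpr hm) (even_iff_two_dvd.mpr h), ?_⟩
    have hNR' : Nat.card ((M.map PadicInt.toZMod).baseChange K').toAffine.Point • R' = 0 := card_nsmul_eq_zero'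
    rw [hN, mul_nsmul'] at hNR'
    -- no `2`-torsion over `K'`
    -- the generic lemma uses the classical `DecidableEq`; point arithmetic does not depend on this choice
    have hbridge : ∀ (d₁ d₂ : DecidableEq K') (n : ℕ) (P : ((M.map PadicInt.toZMod).baseChange K').toAffine.Point),
        (letI : DecidableEq K' := d₁; n • P) = (letI : DecidableEq K' := d₂; n • P) := by
      intro d₁ d₂ n P
      obtain rfl : d₁ = d₂ := Subsingleton.elim _ _
      rfl
    have hNR'' := (hbridge inferInstance (fun a b ↦ Classical.propDecidable (a = b)) (2 ^ k) (m • R')).symm.trans hNR'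
    have hmR' : m • R' = 0 :=
      eq_zero_of_two_pow_nsmul_eq_zero_reduction M htr (algebraMap (ZMod 2) K') (m • R') k hNR''
    have := congrArg (Affine.Point.map K'.val) hmR'
    rw [map_nsmul, hmap, map_zero] at this
    exact this

end Two

end Summit.BirchSwinnertonDyer.BirchSwinnertonDyer.Theorems.SignedTransportAtTwo

end
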